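import Mathlib

/-!
# Hodge-locus census — the pencil EXCESS BOUND `e(λ) ≤ dim J` (def-free helper of `stmt-HodgeConjecture-16267`)

Cell records `og81/FERMAT-PAIRS-ALL-DEGREES-g29.md` (THEOREM 1 (iii)/(iv)) and `og81/FERMAT-POINT-STRUCTURE-g30.md` (§3b COROLLARY 7,
§4 (i) 'λ-free complement'), pub-hlocus lead gen 30.  For a pair of plane classes `[P], [P']` on the Fermat variety the tangent space to the
Hodge locus of `[P] + λ[P']` in degree `a` is the kernel of the pencil member `α_a + λ β_a` (`α`, `β` = the class-action maps of `P`, `P'`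
on the Jacobian ring), the pair locus has tangent space `ker α_a ∩ ker β_a`, and the census's EXCESS is
  `e_a(λ) := dim ker(α_a + λ β_a) - dim(ker α_a ∩ ker β_a)`,   with   `J_a := im α_a ∩ im β_a`.
This file kernel-checks, for arbitrary linear maps `α, β : V → W` of finite-dimensional vector spaces over any field and `c ≠ 0`:
  * `finrank_ker_add_smul_le` / `excess_le_finrank_range_inf`:  `e(c) ≤ dim(im α ∩ im β)` — the map `v ↦ α v` sends `ker(α + cβ)` into
    `im α ∩ im β` (as `α v = -c·β v`) with kernel exactly `ker α ∩ ker β`;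
  * `ker_add_smul_eq_of_range_inf_eq_bot`:  if `im α ∩ im β = 0` then `ker(α + cβ) = ker α ∩ ker β` for EVERY `c ≠ 0` — no special value
    at all (the linear-algebra core of COROLLARY 7: pair types with `J_d = 0` have special set `{0, ∞}` only; and of §4 (i): at level `k₀`
    the computed `dim J_a = 0` for `a < d` excludes special values below degree `d` for every `λ`, not only the sampled ones).
Scalars: the census uses `λ ∈ ℂ^×` (or `ℚ(ζ_{2d})^×`); here `c` is any non-zero element of any field `K`.
What is NOT formalised: the identification of the Hodge-locus tangent spaces with these kernels ([Klo25b, Lemma 3.6]) and any computed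
value of `dim J_a` — this is the abstract inequality only.

certified instances and evidence bearing on the general Hodge conjecture; no claim.
-/

namespace Summit.HodgeConjecture.HodgeConjecture.HodgeLocus.Census.PencilExcessBound

variable {K : Type*} [Field K] {V W : Type*} [AddCommGroup V] [Module K V] [AddCommGroup W] [Module K W]

/-- For `c ≠ 0` the pencil kernel `ker(α + cβ)` contains `ker α ∩ ker β`, and `v ↦ α v` maps it into `im α ∩ im β` with kernel
`ker α ∩ ker β`; hence the EXCESS `dim ker(α + cβ) - dim(ker α ∩ ker β)` is at most `dim(im α ∩ im β)`. -/
theorem finrank_ker_add_smul_le [FiniteDimensional K V] [FiniteDimensional K W] (α β : V →ₗ[K] W) {c : K} (hc : c ≠ 0) :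
    Module.finrank K ↥(LinearMap.ker (α + c • β))
      ≤ Module.finrank K ↥(LinearMap.ker α ⊓ LinearMap.ker β)
        + Module.finrank K ↥(LinearMap.range α ⊓ LinearMap.range β) := by
  set S := LinearMap.ker (α + c • β) with hS
  set φ : ↥S →ₗ[K] W := α.comp S.subtype with hφ
  have hmem : ∀ v : ↥S, α (v : V) + c • β (v : V) = 0 := by
    intro v
    have hv : (α + c • β) (v : V) = 0 := LinearMap.mem_ker.mp v.2
    rw [LinearMap.add_apply, LinearMap.smul_apply] at hv
    exact hv
  have hrange : LinearMap.range φ ≤ LinearMap.range α ⊓ LinearMap.range β := by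
    intro w hw
    obtain ⟨v, rfl⟩ := LinearMap.mem_range.mp hw
    refine Submodule.mem_inf.mpr ⟨LinearMap.mem_range.mpr ⟨(v : V), rfl⟩, LinearMap.mem_range.mpr ⟨-(c • (v : V)), ?_⟩⟩
    have h := hmem v
    rw [map_neg, map_smul, hφ, LinearMap.comp_apply, Submodule.subtype_apply]
    exact (eq_neg_of_add_eq_zero_left h).symm
  have hkerle : Submodule.map S.subtype (LinearMap.ker φ) ≤ LinearMap.ker α ⊓ LinearMap.ker β := by
    intro x hx
    obtain ⟨v, hv, rfl⟩ := Submodule.mem_map.mp hx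
    have hv' : α (v : V) = 0 := by
      rw [LinearMap.mem_ker, hφ, LinearMap.comp_apply, Submodule.subtype_apply] at hv
      exact hv
    have h := hmem v
    rw [hv', zero_add] at h
    refine Submodule.mem_inf.mpr ⟨?_, ?_⟩
    · rw [LinearMap.mem_ker, Submodule.subtype_apply]; exact hv'
    · rw [LinearMap.mem_ker, Submodule.subtype_apply]; exact (smul_eq_zero.mp h).resolve_left hc
  have h1 : Module.finrank K ↥(LinearMap.ker φ) ≤ Module.finrank K ↥(LinearMap.ker α ⊓ LinearMap.ker β) := by
    rw [(Submodule.equivMapOfInjective S.subtype (Submodule.injective_subtype S) (LinearMap.ker φ)).finrank_eq]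
    exact Submodule.finrank_mono hkerle
  have h2 : Module.finrank K ↥(LinearMap.range φ) ≤ Module.finrank K ↥(LinearMap.range α ⊓ LinearMap.range β) :=
    Submodule.finrank_mono hrange
  have h3 := LinearMap.finrank_range_add_finrank_ker φ
  omega

/-- In particular, if `im α ∩ im β = 0` the pencil has NO special value: `ker(α + cβ) = ker α ∩ ker β` for every `c ≠ 0`. -/
theorem ker_add_smul_eq_of_range_inf_eq_bot (α β : V →ₗ[K] W) (hJ : LinearMap.range α ⊓ LinearMap.range β = ⊥) {c : K} (hc : c ≠ 0) :
    LinearMap.ker (α + c • β) = LinearMap.ker α ⊓ LinearMap.ker β := by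
  apply le_antisymm
  · intro v hv
    rw [LinearMap.mem_ker, LinearMap.add_apply, LinearMap.smul_apply] at hv
    have hα : α v ∈ LinearMap.range α ⊓ LinearMap.range β := by
      refine Submodule.mem_inf.mpr ⟨LinearMap.mem_range.mpr ⟨v, rfl⟩, LinearMap.mem_range.mpr ⟨-(c • v), ?_⟩⟩
      rw [map_neg, map_smul]
      exact (eq_neg_of_add_eq_zero_left hv).symm
    rw [hJ, Submodule.mem_bot] at hα
    rw [hα, zero_add] at hv
    refine Submodule.mem_inf.mpr ⟨?_, ?_⟩
    · rw [LinearMap.mem_ker]; exact hα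
    · rw [LinearMap.mem_ker]; exact (smul_eq_zero.mp hv).resolve_left hc
  · intro v hv
    obtain ⟨h1, h2⟩ := Submodule.mem_inf.mp hv
    rw [LinearMap.mem_ker] at h1 h2 ⊢
    rw [LinearMap.add_apply, LinearMap.smul_apply, h1, h2, smul_zero, add_zero]

/-- The excess form: `dim ker(α + cβ) - dim(ker α ∩ ker β) ≤ dim(im α ∩ im β)` (`c ≠ 0`). -/
theorem excess_le_finrank_range_inf [FiniteDimensional K V] [FiniteDimensional K W] (α β : V →ₗ[K] W) {c : K} (hc : c ≠ 0) :
    Module.finrank K ↥(LinearMap.ker (α + c • β)) - Module.finrank K ↥(LinearMap.ker α ⊓ LinearMap.ker β)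
      ≤ Module.finrank K ↥(LinearMap.range α ⊓ LinearMap.range β) := by
  have := finrank_ker_add_smul_le α β hc
  omega

end Summit.HodgeConjecture.HodgeConjecture.HodgeLocus.Census.PencilExcessBound
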